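import Summits.QuantumFields.QCD.Theorems.SpectralDefectExtinctionWindowExtinctionSpreadMixtureOdds
import Summits.QuantumFields.QCD.Theorems.SpectralDefectExtinctionWindowExtinctionStubFiberAtomMonotoneCoupling
import Mathlib.MeasureTheory.Integral.Marginal
import Mathlib.MeasureTheory.Integral.Bochner.Set

/-!
# Fibre anti-concentration under an `e^{±τ}` mixture of a product law — monotone form

Stub `stub_fiberAtomMonotone` (S4″, reshape r3) of line `free-volume-heavy-witness`
(crux `Summit.QuantumFields.QCD.Theses.SpectralDefectExtinction.WindowExtinction`,
item stmt-QuantumFields-8964).  Pure measure theory, no project vocabulary; the monotone twin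
of the landed `spread_fiber_atom_le_of_odds` (exact increments, Littlewood–Offord): here the
integer statistic `X` is only STRICTLY INCREASING under a single `Tm → Tp` refill of a
coordinate of `S'`, and the anti-concentration input is the weighted antichain (Sperner/LYM)
bound for biased product laws on `Fin N → Bool`, taken as a hypothesis (it is the conclusion of
stub `stub_antichainWeight`).

Proof.  Peel `e^{φ}` into `e^{±τ} e^{a} ∏ᵢ Fᵢ(tᵢ)` on the active box (losing `e^{τ}` twice),
freeze the coordinates off `S'` (Tonelli, Mathlib `lmarginal`) and apply the fibre bound
`fam_fiber_core` (representative coupling, `…StubFiberAtomMonotoneCoupling.lean`) on the fibre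
`↥S' → T`; the antichain hypothesis is transported to the one-coordinate masses
`∫_{Tp} e^{bᵢ}`, `∫_{Tm} e^{bᵢ}` by `fam_antichain_product`, their non-degeneracy being the odds
hypothesis read through `integral_eq_lintegral_of_nonneg_ae`.  In the degenerate case `ν Tm = 0`
the atom is compared with the total directly, the antichain hypothesis (singleton antichain
`{tt…tt}`) forcing `C/√(|S'|+1) ≥ 1`.
-/

noncomputable section

namespace Summit.QuantumFields.QCD.Cruxes.WindowExtinction.FreeVolumeHeavyWitness

open MeasureTheory Set Function
open scoped ENNReal BigOperators Classical

/-- **Stub `stub_fiberAtomMonotone` (fibre anti-concentration, monotone form).**  On the finite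
product `I → T` with the product `ν^{⊗I}` of a probability measure, let `e^{φ}` be a weight
which on the active box `(Tp ∪ Tm)^I` is within `e^{±τ}` of a product weight
`e^{a} ∏ᵢ e^{bᵢ(tᵢ)}` whose factors oscillate by at most `B` on `Tp ∪ Tm` and whose
one-coordinate odds are non-degenerate,
`ε ∫_{Tp ∪ Tm} e^{bᵢ} dν ≤ ∫_{Tp} e^{bᵢ} dν ≤ (1 - ε) ∫_{Tp ∪ Tm} e^{bᵢ} dν`, and let `X` be a
measurable integer statistic which INCREASES BY AT LEAST ONE under every single refill of a
coordinate `i ∈ S'` from `Tm` to `Tp` (all other coordinates active).  If every antichain of the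
cube `Fin N → Bool` has biased-product weight at most `C/√(N+1)` for biases in `[ε, 1-ε]`
(the weighted Sperner bound, stub `stub_antichainWeight`), then every atom of `X` carries at
most the fraction `e^{2τ} C/√(|S'|+1)` of the active mass:
`∫_{active, X = j} e^{φ} ≤ e^{2τ} C/√(|S'|+1) ∫_{active} e^{φ}`. -/
theorem stub_fiberAtomMonotone :
    ∀ {I T : Type} [Fintype I] [DecidableEq I] [MeasurableSpace T]
      (ν : Measure T) [IsProbabilityMeasure ν] {Tp Tm : Set T},
      MeasurableSet Tp → MeasurableSet Tm → Disjoint Tp Tm → ν Tp ≠ 0 →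
      ∀ {ε C : ℝ},
      (∀ (N : ℕ) (p : Fin N → ℝ), (∀ i, ε ≤ p i ∧ p i ≤ 1 - ε) →
        ∀ 𝒜 : Finset (Fin N → Bool), (∀ s ∈ 𝒜, ∀ s' ∈ 𝒜, (∀ i, s i ≤ s' i) → s = s') →
          ∑ s ∈ 𝒜, ∏ i, (if s i then p i else 1 - p i) ≤ C / Real.sqrt (N + 1)) →
      ∀ {φ : (I → T) → ℝ}, Measurable φ → ∀ {a τ B : ℝ} {b : I → T → ℝ},
      (∀ i, Measurable (b i)) →
      (∀ t : I → T, (∀ i, t i ∈ Tp ∪ Tm) → |φ t - a - ∑ i, b i (t i)| ≤ τ) →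
      (∀ i u u', u ∈ Tp ∪ Tm → u' ∈ Tp ∪ Tm → b i u ≤ b i u' + B) →
      (∀ i, ε * ∫ u in Tp ∪ Tm, Real.exp (b i u) ∂ν ≤ ∫ u in Tp, Real.exp (b i u) ∂ν ∧
        ∫ u in Tp, Real.exp (b i u) ∂ν ≤ (1 - ε) * ∫ u in Tp ∪ Tm, Real.exp (b i u) ∂ν) →
      ∀ {X : (I → T) → ℤ}, Measurable X → ∀ (S' : Finset I),
      (∀ t : I → T, (∀ i, t i ∈ Tp ∪ Tm) → ∀ i ∈ S', ∀ u ∈ Tp, t i ∈ Tm →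
        X t + 1 ≤ X (Function.update t i u)) →
      ∀ (j : ℤ),
      ∫⁻ t, (Set.pi Set.univ fun _ : I => Tp ∪ Tm).indicator
          (fun t => if X t = j then ENNReal.ofReal (Real.exp (φ t)) else 0) t
          ∂Measure.pi (fun _ : I => ν) ≤
        ENNReal.ofReal (Real.exp (2 * τ) * C / Real.sqrt (S'.card + 1)) *
          ∫⁻ t, (Set.pi Set.univ fun _ : I => Tp ∪ Tm).indicator
            (fun t => ENNReal.ofReal (Real.exp (φ t))) t ∂Measure.pi (fun _ : I => ν) := by
  intro I T _ _ _ ν _ Tp Tm hTp hTm hdisj hTp0 ε C hAC φ hφm a τ B b hbm hφ hb hodds X hXm S' hX j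
  -- notation
  set Box : Set (I → T) := Set.pi Set.univ fun _ : I => Tp ∪ Tm with hBox_def
  set F : I → T → ℝ≥0∞ := fun i u => ENNReal.ofReal (Real.exp (b i u)) with hF_def
  set g1 : (I → T) → ℝ≥0∞ := Box.indicator fun t => if X t = j then ∏ i, F i (t i) else 0
    with hg1_def
  set g0 : (I → T) → ℝ≥0∞ := Box.indicator fun t => ∏ i, F i (t i) with hg0_def
  set c : ℝ≥0∞ := ENNReal.ofReal (C / Real.sqrt (S'.card + 1)) with hc_def
  -- `C ≥ 1` from the empty cube
  have hC1 : 1 ≤ C := by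
    have h := hAC 0 Fin.elim0 (fun i => Fin.elim0 i) Finset.univ
      (fun s _ s' _ _ => Subsingleton.elim s s')
    simpa using h
  have hC0 : 0 ≤ C := zero_le_one.trans hC1
  -- measurability
  have hBox : MeasurableSet Box := MeasurableSet.univ_pi fun _ => hTp.union hTm
  have hF : ∀ i, Measurable (F i) := fun i => (hbm i).exp.ennreal_ofReal
  have hprod : Measurable fun t : I → T => ∏ i, F i (t i) :=
    Finset.measurable_prod _ fun i _ => (hF i).comp (measurable_pi_apply i)
  have hXj : MeasurableSet {t : I → T | X t = j} := hXm (measurableSet_singleton j)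
  have hg1m : Measurable g1 := (Measurable.ite hXj hprod measurable_const).indicator hBox
  have hg0m : Measurable g0 := hprod.indicator hBox
  have hρm : Measurable fun t : I → T => ENNReal.ofReal (Real.exp (φ t)) := hφm.exp.ennreal_ofReal
  -- a reference active value
  obtain ⟨u₀, hu₀⟩ : Tp.Nonempty := nonempty_of_measure_ne_zero hTp0
  have hu₀' : u₀ ∈ Tp ∪ Tm := Or.inl hu₀
  -- Step A: the weight is below `e^{τ+a} ∏ F` on the active box
  have hexp_prod : ∀ t : I → T, ENNReal.ofReal (Real.exp (∑ i, b i (t i))) = ∏ i, F i (t i) := by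
    intro t
    rw [Real.exp_sum, ENNReal.ofReal_prod_of_nonneg fun i _ => (Real.exp_pos _).le]
  have hA : ∀ t, Box.indicator (fun t => if X t = j then ENNReal.ofReal (Real.exp (φ t)) else 0) t ≤
      ENNReal.ofReal (Real.exp (τ + a)) * g1 t := by
    intro t
    by_cases ht : t ∈ Box
    · rw [hg1_def, indicator_of_mem ht, indicator_of_mem ht]
      by_cases hj : X t = j
      · rw [if_pos hj, if_pos hj, ← hexp_prod, ← ENNReal.ofReal_mul (Real.exp_pos _).le,
          ← Real.exp_add]
        refine ENNReal.ofReal_le_ofReal (Real.exp_le_exp.2 ?_)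
        have := (abs_le.1 (hφ t fun i => ht i (mem_univ _))).2
        linarith
      · rw [if_neg hj, if_neg hj]; exact zero_le
    · rw [hg1_def, indicator_of_notMem ht, indicator_of_notMem ht]; exact zero_le
  -- Step C: `∏ F` is below `e^{τ-a} e^{φ}` on the active box
  have hCstep : ∀ t, g0 t ≤ ENNReal.ofReal (Real.exp (τ - a)) *
      Box.indicator (fun t => ENNReal.ofReal (Real.exp (φ t))) t := by
    intro t
    by_cases ht : t ∈ Box
    · rw [hg0_def, indicator_of_mem ht, indicator_of_mem ht, ← hexp_prod,
        ← ENNReal.ofReal_mul (Real.exp_pos _).le, ← Real.exp_add]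
      refine ENNReal.ofReal_le_ofReal (Real.exp_le_exp.2 ?_)
      have := (abs_le.1 (hφ t fun i => ht i (mem_univ _))).1
      linarith
    · rw [hg0_def, indicator_of_notMem ht, indicator_of_notMem ht]; exact zero_le
  -- One-coordinate masses, their finiteness, positivity and odds
  set G : I → Bool → ℝ≥0∞ := fun i bb => ∫⁻ u, (if bb then Tp else Tm).indicator (F i) u ∂ν
    with hG_def
  have hbound : ∀ (i : I) (u : T), u ∈ Tp ∪ Tm →
      ENNReal.ofReal (Real.exp (b i u₀ - B)) ≤ F i u ∧
        F i u ≤ ENNReal.ofReal (Real.exp (b i u₀ + B)) := by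
    intro i u hu
    have h1 := hb i u₀ u hu₀' hu
    have h2 := hb i u u₀ hu hu₀'
    exact ⟨ENNReal.ofReal_le_ofReal (Real.exp_le_exp.2 (by linarith)),
      ENNReal.ofReal_le_ofReal (Real.exp_le_exp.2 (by linarith))⟩
  have hGbounds : ∀ (i : I) (bb : Bool),
      ENNReal.ofReal (Real.exp (b i u₀ - B)) * ν (if bb then Tp else Tm) ≤ G i bb ∧
        G i bb ≤ ENNReal.ofReal (Real.exp (b i u₀ + B)) * ν (if bb then Tp else Tm) := by
    intro i bb
    have hTb : MeasurableSet (if bb then Tp else Tm) := by cases bb <;> simp [hTp, hTm]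
    have hsub : (if bb then Tp else Tm) ⊆ Tp ∪ Tm := by
      cases bb
      · exact subset_union_right
      · exact subset_union_left
    constructor
    · rw [hG_def]
      simp only
      rw [lintegral_indicator hTb, ← setLIntegral_const]
      exact setLIntegral_mono (hF i) fun u hu => (hbound i u (hsub hu)).1
    · rw [hG_def]
      simp only
      rw [lintegral_indicator hTb, ← setLIntegral_const]
      exact setLIntegral_mono measurable_const fun u hu => (hbound i u (hsub hu)).2
  have hGfin : ∀ (i : I) (bb : Bool), G i bb ≠ ∞ := fun i bb =>
    ne_top_of_le_ne_top (ENNReal.mul_ne_top ENNReal.ofReal_ne_top (measure_ne_top _ _))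
      (hGbounds i bb).2
  have hGpos : ∀ (i : I) (bb : Bool), ν (if bb then Tp else Tm) ≠ 0 → G i bb ≠ 0 :=
    fun i bb hne => (lt_of_lt_of_le
      (ENNReal.mul_pos (ENNReal.ofReal_pos.2 (Real.exp_pos _)).ne' hne) (hGbounds i bb).1).ne'
  have hGpos_t : ∀ i : I, G i true ≠ 0 := fun i => hGpos i true (by simpa using hTp0)
  set w : I → Bool → ℝ := fun i bb => (G i bb).toReal with hw_def
  have hGw : ∀ i bb, G i bb = ENNReal.ofReal (w i bb) := fun i bb =>
    (ENNReal.ofReal_toReal (hGfin i bb)).symm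
  have hw0 : ∀ i bb, 0 ≤ w i bb := fun i bb => ENNReal.toReal_nonneg
  have hwG : ∀ i bb, w i bb = (G i bb).toReal := fun _ _ => rfl
  have hmp : 0 < (ν Tp).toReal := ENNReal.toReal_pos hTp0 (measure_ne_top _ _)
  have hwtpos : ∀ i : I, 0 < w i true := by
    intro i
    have h1 := ENNReal.toReal_mono (hGfin i true) (hGbounds i true).1
    rw [ENNReal.toReal_mul, ENNReal.toReal_ofReal (Real.exp_pos _).le, ← hwG] at h1
    simp only [if_true] at h1
    have : 0 < Real.exp (b i u₀ - B) * (ν Tp).toReal := mul_pos (Real.exp_pos _) hmp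
    linarith
  have hwpos : ∀ i : I, 0 < w i true + w i false := fun i => by
    linarith [hwtpos i, hw0 i false]
  -- the one-coordinate masses are the set integrals of `e^{b i}`
  have hG_set : ∀ (i : I) (A : Set T), MeasurableSet A →
      (∫⁻ u, A.indicator (F i) u ∂ν).toReal = ∫ u in A, Real.exp (b i u) ∂ν := by
    intro i A hA
    rw [lintegral_indicator hA, integral_eq_lintegral_of_nonneg_ae
      (Filter.Eventually.of_forall fun u => (Real.exp_pos (b i u)).le)
      (hbm i).exp.aestronglyMeasurable]
  have hG_t : ∀ i : I, G i true = ∫⁻ u, Tp.indicator (F i) u ∂ν := fun i => by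
    simp only [hG_def, if_true]
  have hG_f : ∀ i : I, G i false = ∫⁻ u, Tm.indicator (F i) u ∂ν := fun i => by
    simp only [hG_def, Bool.false_eq_true, if_false]
  have hw_t : ∀ i : I, w i true = ∫ u in Tp, Real.exp (b i u) ∂ν := fun i => by
    rw [hwG, hG_t, hG_set i Tp hTp]
  have hw_u : ∀ i : I, ∫ u in Tp ∪ Tm, Real.exp (b i u) ∂ν = w i true + w i false := by
    intro i
    have h1 : ∫⁻ u, (Tp ∪ Tm).indicator (F i) u ∂ν = G i true + G i false := by
      rw [hG_t, hG_f, lintegral_indicator (hTp.union hTm), lintegral_union hTm hdisj,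
        lintegral_indicator hTp, lintegral_indicator hTm]
    rw [← hG_set i (Tp ∪ Tm) (hTp.union hTm), h1,
      ENNReal.toReal_add (hGfin i true) (hGfin i false), hwG, hwG]
  -- non-degeneracy of the induced bits, from the odds hypothesis
  have hratio : ∀ i : I, ε ≤ w i true / (w i true + w i false) ∧
      w i true / (w i true + w i false) ≤ 1 - ε := by
    intro i
    obtain ⟨h1, h2⟩ := hodds i
    rw [hw_u i, ← hw_t i] at h1 h2
    exact ⟨(le_div_iff₀ (hwpos i)).2 h1, (div_le_iff₀ (hwpos i)).2 h2⟩
  -- pattern sums in `ℝ≥0∞` versus `ℝ`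
  have hsumG : ∀ K : Finset (↥S' → Bool),
      ∑ σ ∈ K, ∏ i : ↥S', G i (σ i) = ENNReal.ofReal (∑ σ ∈ K, ∏ i : ↥S', w i (σ i)) := by
    intro K
    rw [ENNReal.ofReal_sum_of_nonneg fun (σ : ↥S' → Bool) _ =>
      Finset.prod_nonneg fun (i : ↥S') _ => hw0 (i : I) (σ i)]
    refine Finset.sum_congr rfl fun σ _ => ?_
    rw [ENNReal.ofReal_prod_of_nonneg fun (i : ↥S') _ => hw0 (i : I) (σ i)]
    exact Finset.prod_congr rfl fun i _ => hGw i (σ i)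
  -- Step B: the core, `∫ g1 ≤ c ∫ g0`
  have hB : ∫⁻ t, g1 t ∂Measure.pi (fun _ : I => ν) ≤ c * ∫⁻ t, g0 t ∂Measure.pi (fun _ : I => ν) := by
    by_cases hTm0 : ν Tm = 0
    · ----------------------------------------------------------------
      -- degenerate case `ν Tm = 0`: the antichain hypothesis forces `c ≥ 1`
      have hGf0 : ∀ i : I, G i false = 0 := fun i =>
        le_antisymm (by simpa [hTm0] using (hGbounds i false).2) zero_le
      have hwf0 : ∀ i : I, w i false = 0 := fun i => by rw [hwG, hGf0]; rfl
      have hweak := fam_antichain_product hAC (fun i : ↥S' => w i) (fun i => hwpos i)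
        (fun i => hratio i) {fun _ => true}
        (fun s hs s' hs' _ => by
          rw [Finset.mem_singleton] at hs hs'
          rw [hs, hs'])
      rw [Finset.sum_singleton, Fintype.card_coe] at hweak
      simp only [hwf0, add_zero] at hweak
      have hPpos : 0 < ∏ i : ↥S', w (i : I) true := Finset.prod_pos fun i _ => hwtpos i
      have hc1 : 1 ≤ C / Real.sqrt (S'.card + 1) :=
        le_of_mul_le_mul_right (by linarith) hPpos
      have hc_one : (1 : ℝ≥0∞) ≤ c := by
        rw [hc_def, ← ENNReal.ofReal_one]
        exact ENNReal.ofReal_le_ofReal hc1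
      have hg10 : ∀ t, g1 t ≤ g0 t := fun t => by
        by_cases ht : t ∈ Box
        · rw [hg1_def, hg0_def, indicator_of_mem ht, indicator_of_mem ht]
          split_ifs
          · exact le_rfl
          · exact zero_le
        · rw [hg1_def, indicator_of_notMem ht]
          exact zero_le
      calc ∫⁻ t, g1 t ∂Measure.pi (fun _ : I => ν) ≤ ∫⁻ t, g0 t ∂Measure.pi (fun _ : I => ν) :=
            lintegral_mono hg10
        _ ≤ c * ∫⁻ t, g0 t ∂Measure.pi (fun _ : I => ν) := le_mul_of_one_le_left zero_le hc_one
    -- non-degenerate case: fibrewise over the coordinates of `S'`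
    have hGpos_f : ∀ i : I, G i false ≠ 0 := fun i => hGpos i false (by simpa using hTm0)
    set t₀ : I → T := fun _ => u₀ with ht₀
    have huniv : (Finset.univ : Finset I) = (Finset.univ \ S') ∪ S' :=
      (Finset.sdiff_union_of_subset (Finset.subset_univ S')).symm
    have hdj : Disjoint (Finset.univ \ S') S' := Finset.sdiff_disjoint
    rw [lintegral_eq_lmarginal_univ t₀, lintegral_eq_lmarginal_univ t₀, huniv,
      lmarginal_union _ g1 hg1m hdj, lmarginal_union _ g0 hg0m hdj,
      ← spread_odds_lmarginal_const_mul ν _ c ENNReal.ofReal_ne_top]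
    refine lmarginal_mono (fun r => ?_) t₀
    -- the fiber over `r`
    change ∫⁻ q, g1 (updateFinset r S' q) ∂Measure.pi (fun _ : ↥S' => ν) ≤
      c * ∫⁻ q, g0 (updateFinset r S' q) ∂Measure.pi (fun _ : ↥S' => ν)
    by_cases hr : ∀ i, i ∉ S' → r i ∈ Tp ∪ Tm
    swap
    · -- some frozen coordinate is inactive: the fiber misses the active box
      have hzero : ∀ q : ↥S' → T, g1 (updateFinset r S' q) = 0 := by
        intro q
        push Not at hr
        obtain ⟨i, hi, hri⟩ := hr
        refine indicator_of_notMem (fun h => hri ?_) _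
        have := h i (mem_univ _)
        simpa [updateFinset, hi] using this
      simp only [hzero, lintegral_const, zero_mul, zero_le]
    -- all frozen coordinates are active
    set BoxS : Set (↥S' → T) := Set.pi Set.univ fun _ : ↥S' => Tp ∪ Tm with hBoxS_def
    set cst : ℝ≥0∞ := ∏ i ∈ S'ᶜ, F i (r i) with hcst_def
    set Y : (↥S' → T) → ℤ := fun q => X (updateFinset r S' q) with hY_def
    -- the integrands in the fiber
    have hmemS : ∀ q : ↥S' → T, updateFinset r S' q ∈ Box ↔ q ∈ BoxS := fun q => by
      rw [hBox_def, spread_odds_updateFinset_mem_pi_iff hr q]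
      exact ⟨fun h i _ => h i, fun h i => h i (mem_univ _)⟩
    have hg1_fiber : ∀ q : ↥S' → T, g1 (updateFinset r S' q) =
        BoxS.indicator (fun q => if Y q = j then ∏ i : ↥S', F i (q i) else 0) q * cst := by
      intro q
      by_cases hq : q ∈ BoxS
      · rw [hg1_def, indicator_of_mem ((hmemS q).2 hq), indicator_of_mem hq,
          spread_odds_prod_updateFinset]
        simp only [hY_def, ite_mul, zero_mul, hcst_def]
      · rw [hg1_def, indicator_of_notMem (fun h => hq ((hmemS q).1 h)), indicator_of_notMem hq,
          zero_mul]
    have hg0_fiber : ∀ q : ↥S' → T, g0 (updateFinset r S' q) =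
        BoxS.indicator (fun q => ∏ i : ↥S', F i (q i)) q * cst := by
      intro q
      by_cases hq : q ∈ BoxS
      · rw [hg0_def, indicator_of_mem ((hmemS q).2 hq), indicator_of_mem hq,
          spread_odds_prod_updateFinset]
      · rw [hg0_def, indicator_of_notMem (fun h => hq ((hmemS q).1 h)), indicator_of_notMem hq,
          zero_mul]
    have hFS : ∀ i : ↥S', Measurable (F i) := fun i => hF i
    have hBoxS : MeasurableSet BoxS := MeasurableSet.univ_pi fun _ => hTp.union hTm
    have hYm : Measurable Y := hXm.comp measurable_updateFinset
    have hprodS : Measurable fun q : ↥S' → T => ∏ i : ↥S', F i (q i) :=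
      Finset.measurable_prod (f := fun (i : ↥S') (q : ↥S' → T) => F i (q i)) _
        fun i _ => (hFS i).comp (measurable_pi_apply i)
    have hmeas1 : Measurable fun q : ↥S' → T => BoxS.indicator (fun q =>
        if Y q = j then ∏ i : ↥S', F i (q i) else 0) q :=
      (Measurable.ite (hYm (measurableSet_singleton _)) hprodS measurable_const).indicator hBoxS
    have hmeas0 : Measurable fun q : ↥S' → T => BoxS.indicator (fun q => ∏ i : ↥S', F i (q i)) q :=
      hprodS.indicator hBoxS
    -- strict monotonicity in the fibre
    have hmonoS : ∀ q : ↥S' → T, (∀ i, q i ∈ Tp ∪ Tm) → ∀ i, ∀ u ∈ Tp, q i ∈ Tm →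
        Y q + 1 ≤ Y (Function.update q i u) := by
      intro q hq i u hu hqi
      have hact : ∀ k, updateFinset r S' q k ∈ Tp ∪ Tm := fun k =>
        (spread_odds_updateFinset_mem_pi_iff hr q).2 hq k (mem_univ _)
      have hti : updateFinset r S' q i ∈ Tm := by simpa [updateFinset, i.2] using hqi
      have := hX _ hact i i.2 u hu hti
      simpa only [hY_def, fam_update_updateFinset] using this
    -- the antichain hypothesis in the fibre, in `ℝ≥0∞`
    have hantiS : ∀ 𝒜 : Finset (↥S' → Bool), (∀ s ∈ 𝒜, ∀ s' ∈ 𝒜, (∀ i, s i ≤ s' i) → s = s') →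
        ∑ σ ∈ 𝒜, ∏ i : ↥S', G i (σ i) ≤ c * ∑ σ : ↥S' → Bool, ∏ i : ↥S', G i (σ i) := by
      intro 𝒜 h𝒜
      have hreal := fam_antichain_product hAC (fun i : ↥S' => w i) (fun i => hwpos i)
        (fun i => hratio i) 𝒜 h𝒜
      rw [Fintype.card_coe, ← spread_sum_pattern_prod (fun (i : ↥S') bb => w i bb)] at hreal
      rw [hsumG, hsumG, hc_def, ← ENNReal.ofReal_mul (div_nonneg hC0 (Real.sqrt_nonneg _))]
      exact ENNReal.ofReal_le_ofReal hreal
    have hcore := fam_fiber_core (J := ↥S') ν hTp hTm hdisj (F := fun i : ↥S' => F i) hFS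
      (fun i bb => hGfin i bb) (fun i bb => by cases bb; exacts [hGpos_f i, hGpos_t i]) hYm hmonoS
      (c := c) hantiS j
    calc ∫⁻ q, g1 (updateFinset r S' q) ∂Measure.pi (fun _ : ↥S' => ν)
        = (∫⁻ q, BoxS.indicator (fun q => if Y q = j then ∏ i : ↥S', F i (q i) else 0) q
            ∂Measure.pi (fun _ : ↥S' => ν)) * cst := by
          simp_rw [hg1_fiber]
          exact lintegral_mul_const _ hmeas1
      _ ≤ (c * ∫⁻ q, BoxS.indicator (fun q => ∏ i : ↥S', F i (q i)) q
            ∂Measure.pi (fun _ : ↥S' => ν)) * cst := mul_le_mul_left hcore cst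
      _ = c * ∫⁻ q, g0 (updateFinset r S' q) ∂Measure.pi (fun _ : ↥S' => ν) := by
          simp_rw [hg0_fiber]
          rw [lintegral_mul_const _ hmeas0, mul_assoc]
  -- assembling A, B, C
  have hA' : ∫⁻ t, Box.indicator (fun t => if X t = j then ENNReal.ofReal (Real.exp (φ t)) else 0) t
      ∂Measure.pi (fun _ : I => ν) ≤
      ENNReal.ofReal (Real.exp (τ + a)) * ∫⁻ t, g1 t ∂Measure.pi (fun _ : I => ν) := by
    rw [← lintegral_const_mul _ hg1m]
    exact lintegral_mono hA
  have hC' : ∫⁻ t, g0 t ∂Measure.pi (fun _ : I => ν) ≤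
      ENNReal.ofReal (Real.exp (τ - a)) *
        ∫⁻ t, Box.indicator (fun t => ENNReal.ofReal (Real.exp (φ t))) t
          ∂Measure.pi (fun _ : I => ν) := by
    rw [← lintegral_const_mul _ (hρm.indicator hBox)]
    exact lintegral_mono hCstep
  have hconst : ENNReal.ofReal (Real.exp (τ + a)) * (c * ENNReal.ofReal (Real.exp (τ - a))) =
      ENNReal.ofReal (Real.exp (2 * τ) * C / Real.sqrt (S'.card + 1)) := by
    rw [hc_def, ← ENNReal.ofReal_mul (div_nonneg hC0 (Real.sqrt_nonneg _)),
      ← ENNReal.ofReal_mul (Real.exp_pos _).le]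
    congr 1
    have : Real.exp (2 * τ) = Real.exp (τ + a) * Real.exp (τ - a) := by
      rw [← Real.exp_add]; ring_nf
    rw [this]
    ring
  calc ∫⁻ t, Box.indicator (fun t => if X t = j then ENNReal.ofReal (Real.exp (φ t)) else 0) t
        ∂Measure.pi (fun _ : I => ν)
      ≤ ENNReal.ofReal (Real.exp (τ + a)) * ∫⁻ t, g1 t ∂Measure.pi (fun _ : I => ν) := hA'
    _ ≤ ENNReal.ofReal (Real.exp (τ + a)) * (c * ∫⁻ t, g0 t ∂Measure.pi (fun _ : I => ν)) :=
        mul_le_mul_right hB _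
    _ ≤ ENNReal.ofReal (Real.exp (τ + a)) * (c * (ENNReal.ofReal (Real.exp (τ - a)) *
          ∫⁻ t, Box.indicator (fun t => ENNReal.ofReal (Real.exp (φ t))) t
            ∂Measure.pi (fun _ : I => ν))) :=
        mul_le_mul_right (mul_le_mul_right hC' _) _
    _ = ENNReal.ofReal (Real.exp (2 * τ) * C / Real.sqrt (S'.card + 1)) *
          ∫⁻ t, Box.indicator (fun t => ENNReal.ofReal (Real.exp (φ t))) t
            ∂Measure.pi (fun _ : I => ν) := by
        rw [← hconst]; simp only [mul_assoc]

end Summit.QuantumFields.QCD.Cruxes.WindowExtinction.FreeVolumeHeavyWitness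

end
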